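import Summits.QuantumFields.YangMills.Theorems.BalabanUVNodesN15KingModelHeatKernelGradientCycleDecay
import Summits.QuantumFields.YangMills.Theorems.BalabanUVNodesN15KingModelHeatKernelProductMajorants
import HarnessLib

/-!
# BalabanUVNodes ∕ N15 — THE KING-MODEL RUNG (PART ∇-d): MAJORANTS FOR THE DIFFERENCED PRODUCT OF CYCLE HEAT KERNELS ON THE CUBIC FOUR-TORUS —
# Region I (`0 < s ≤ |v(z_μ)|²`, ANY coordinate `μ`): `‖∇Q_s(z_ν)‖·Π_{μ′≠ν}‖Q_s(z_{μ′})‖ ≤ 308700∕(|v(z_μ)|⁴·√s)`; Region II (every `s > 0`): `≤ 2π·e^{−8s∕K₀²}∕(s·K₀³) + 2π∕(s²√s)`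
# (the pointwise input of PART ∇-e's time integral: `∫₀^{n²}ds∕√s = 2n` and `∫_{n²}^∞(s^{−5∕2} + e^{−8s∕K₀²}∕(sK₀³))ds = O(n⁻³)` — the inverse CUBE, mass-free)
# (Track A, DAG node N15 = NE2; FAN-OUT v1.1 §N15 s3 «KING-MODEL RUNG … + what the curved case adds»; count-neutral)

HONEST FRAMING.  Count-neutral (cell `pub-ymgap`, seat `pub-ymgap-dag-n15-e` g57; `--supports stmt-QuantumFields-27247 --as helper` = K3ᴬ).  Elementary real-number bookkeeping for PART ∇ (the
η-uniform inverse-cube law for the lattice gradient of King's `A = 0` covariance): no torus Green's function and no field theory in this file — only the one-dimensional cycle kernels of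
PARTS Ϣ-d∕∇-b and their three bounds each, (B1) `‖Q_s‖ ≤ 1`, (B2) MIXING `‖Q_s‖ ≤ 1∕K + 1∕√s` (Ϣ-g), (B3) DECAY `‖Q_s(n)‖ ≤ (98s+588s²)(9∕K+1∕√s)∕|v(n)|⁴` (Ϣ-g), and for the differenced kernel
(G1) `‖∇Q_s‖ ≤ 2`, (G2) MIXING `‖∇Q_s‖ ≤ (π∕(2s))e^{−8s∕K²} ≤ 2∕s` (∇-b: no zero mode), (G3) DECAY `‖∇Q_s(n)‖ ≤ 7·D(√s, K)∕|v(n)|⁴`, `D(r,N) = (1+12r+24r²+60r³)(9∕N+1∕r) + (14r²+84r⁴)·7·(56∕N²+1∕(4r²)+8∕(Nr))`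
(∇-c with `(π∕2)⁴ ≤ 7`, `2π ≤ 7`, `√(2s) ≤ (3∕2)√s`, `√(π∕(4s)), √(π∕(8s)) ≤ 1∕√s`), combined over the four coordinates of `(ℤ∕K₀)⁴` with ONE factor differenced.
THE TWO NUMERIC HEARTS (`0 < r = √s ≤ n = |v| ≤ N∕2 = K₀∕2`, `n ≥ 1`): ★ `grad_near_numeric_bound_self` — the differenced factor carries the decay (`μ = ν`): `D(r,N)·min(1,(1∕N+1∕r)³) ≤ 44100∕r`
(`r ≤ 1`: `D ≤ 13053∕r`; `r ≥ 1`: `D ≤ 13053r²`, `(3∕(2r))³`); ★ `grad_near_numeric_bound_trans` — a transverse factor carries the decay (`μ ≠ ν`): `min(2,2∕r²)·(98r²+588r⁴)(9∕N+1∕r)·min(1,(1∕N+1∕r)²) ≤ 17000∕r`.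
In both cases the product is `O(n⁻⁴·s^{−1∕2})` on `(0, n²]` — ONE HALF-POWER of `s` below PART Ϣ-g's `17000∕n⁴` for the undifferenced product — and that half-power is the whole difference between
`∫₀^{n²} = O(n²)` (inverse square) and `∫₀^{n²} = O(n)` (inverse cube).
CONTENTS.  §1 constants and the three `∇Q` bounds in `√s`-form (`norm_cycleHeatGrad_le_two_div`, ★ `norm_cycleHeatGrad_le_decayPoly`); §2 the two numeric hearts; §3 products over `Fin 4` with one
index erased (`prod_erase_le_pow_three`, `prod_erase_le_mul_pow_two`); §4 the majorants on `Tor (cM K₀)`: `gradProd_le_two` (G1·B1³), ★★ **`gradProd_le_far`** (Region II), ★★ **`gradProd_le_near`**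
(Region I, every coordinate `μ`, both cases).
PRIOR TREE ART (by name): PART Ϣ-g (`pi_div_two_pow_four_le`, `sqrt_pi_div_le_inv_sqrt`, `norm_cycleHeat_le_inv_add_inv_sqrt`, `norm_cycleHeat_le_poly_div`), Ϣ-d (`norm_cycleHeat_le_one`), ∇-b
(`norm_cycleHeatGrad_le_two`, `norm_cycleHeatGrad_le_mixing`), ∇-c (`norm_cycleHeatGrad_le_decay`).  The one-liners `(a+b)³ ≤ 4(a³+b³)` (`FluidPDE.Torus.add_pow_three_le`) are cited, inlined.
Dedup (rg at filing): basename 0 files; needles `gradProd_le_near|gradProd_le_far|grad_near_numeric_bound|norm_cycleHeatGrad_le_decayPoly|prod_erase_le_mul_pow_two` 0 tree files.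
Locators: [King1986] (2.13) p.653, (4.4) p.670, (4.35) p.674, (3.63) p.663; [LawlerLimic2010] §2.3 ∕ Thm 4.3.1 (the heat-kernel route to Green's function and gradient bounds).  0 `sorry`, 0 `def`.
-/

noncomputable section

open Real Set Finset Complex
open scoped BigOperators

namespace Summit.QuantumFields.YangMills.BalabanUVNodes.N15KingModelRung.HeatKernel

open Literature.MathematicalPhysics.QuantumFieldTheory.Balaban1983to89.B5Prop11Plancherel (Tor)
open Literature.MathematicalPhysics.QuantumFieldTheory.Balaban1983to89.Beta.WoodburyFibre (cM)

/-! ## §1 The three bounds on `∇Q` in `√s`-form -/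

variable {K : ℕ} [NeZero K]

/-- (G2) `‖∇Q^{(K)}_s(n)‖ ≤ 2∕s` (`s > 0`; PART ∇-b's mixing bound with `π∕2 ≤ 2` and the mixing factor dropped). [cite: King1986, (4.4) p.670, (4.35) p.674] -/
theorem norm_cycleHeatGrad_le_two_div {s : ℝ} (hs : 0 < s) (n : ZMod K) : ‖cycleHeatGrad K s n‖ ≤ 2 / s := by
  refine (norm_cycleHeatGrad_le_mixing' hs n).trans ?_
  rw [div_le_div_iff₀ (by positivity) hs]
  nlinarith [Real.pi_lt_d2]

/-- (G2) with the mixing factor kept: `‖∇Q_s(n)‖ ≤ (2∕s)·e^{−8s∕K²}`. [cite: King1986, (4.4) p.670, (4.35) p.674] -/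
theorem norm_cycleHeatGrad_le_two_div_mul_exp {s : ℝ} (hs : 0 < s) (n : ZMod K) : ‖cycleHeatGrad K s n‖ ≤ 2 / s * Real.exp (-(8 * s / (K : ℝ) ^ 2)) := by
  refine (norm_cycleHeatGrad_le_mixing hs n).trans (mul_le_mul_of_nonneg_right ?_ (Real.exp_pos _).le)
  rw [div_le_div_iff₀ (by positivity) hs]
  nlinarith [Real.pi_lt_d2]

/-- `√(2s) ≤ (3∕2)√s`, `√(π∕(8(s∕2))) ≤ 1∕√s`, `2π ≤ 7` — the numeric simplifications of PART ∇-c's bracket. [folklore] -/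
theorem sqrt_two_mul_le (s : ℝ) : Real.sqrt (2 * s) ≤ 3 / 2 * Real.sqrt s := by
  rw [Real.sqrt_mul (by norm_num : (0:ℝ) ≤ 2)]
  refine mul_le_mul_of_nonneg_right ?_ (Real.sqrt_nonneg _)
  rw [show (3 / 2 : ℝ) = Real.sqrt ((3 / 2) ^ 2) by rw [Real.sqrt_sq (by norm_num)]]
  exact Real.sqrt_le_sqrt (by norm_num)

/-- `√(π∕(8(s∕2))) ≤ 1∕√s` (`π∕4 ≤ 1`). [folklore] -/
theorem sqrt_pi_div_half_le_inv_sqrt {s : ℝ} (hs : 0 < s) : Real.sqrt (π / (8 * (s / 2))) ≤ (Real.sqrt s)⁻¹ := by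
  have hπ : π ≤ 4 := by linarith [Real.pi_lt_d2]
  rw [← Real.sqrt_inv]
  apply Real.sqrt_le_sqrt
  rw [div_le_iff₀ (by positivity), inv_mul_eq_div, le_div_iff₀ hs]
  nlinarith

/-- ★ (G3) **THE DECAY OF `∇Q` IN `√s`-FORM**: for `s > 0`, `n ≠ 0`, with `r = √s`:
`‖∇Q^{(K)}_s(n)‖ ≤ 7·[(1+12r+24r²+60r³)(9∕K+1∕r) + (14r²+84r⁴)·7·(56∕K²+1∕(4r²)+8∕(Kr))]∕|v(n)|⁴` (PART ∇-c `norm_cycleHeatGrad_le_decay` with `(π∕2)⁴ ≤ 7`, `2π ≤ 7`, `√(2s) ≤ (3∕2)r`, `√(π∕(4s)), √(π∕(8s)) ≤ 1∕r`).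
[cite: King1986, (4.4) p.670, (4.35) p.674, (3.63) p.663] -/
theorem norm_cycleHeatGrad_le_decayPoly {s : ℝ} (hs : 0 < s) {n : ZMod K} (hn : n ≠ 0) :
    ‖cycleHeatGrad K s n‖ ≤ 7 * ((1 + 12 * Real.sqrt s + 24 * Real.sqrt s ^ 2 + 60 * Real.sqrt s ^ 3) * (9 / K + 1 / Real.sqrt s)
      + (14 * Real.sqrt s ^ 2 + 84 * Real.sqrt s ^ 4) * 7 * (56 / (K : ℝ) ^ 2 + 1 / (4 * Real.sqrt s ^ 2) + 8 / (K * Real.sqrt s))) / ((n.valMinAbs.natAbs : ℕ) : ℝ) ^ 4 := by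
  have hK : (0 : ℝ) < K := by exact_mod_cast Nat.pos_of_ne_zero (NeZero.ne K)
  set r := Real.sqrt s with hr
  have hr0 : 0 < r := Real.sqrt_pos.mpr hs
  have hrs : r ^ 2 = s := Real.sq_sqrt hs.le
  have hv : (0 : ℝ) < ((n.valMinAbs.natAbs : ℕ) : ℝ) ^ 4 := by
    have : 0 < n.valMinAbs.natAbs := by rw [Nat.pos_iff_ne_zero, Ne, Int.natAbs_eq_zero, ZMod.valMinAbs_eq_zero]; exact hn
    positivity
  refine (norm_cycleHeatGrad_le_decay hs hn).trans (div_le_div_of_nonneg_right ?_ hv.le)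
  have h7 := pi_div_two_pow_four_le
  have h2π : 2 * π ≤ 7 := by linarith [Real.pi_lt_d2]
  have hA1 := sqrt_two_mul_le s
  have hA2 := sqrt_pi_div_half_le_inv_sqrt hs
  have hA3 := sqrt_pi_div_le_inv_sqrt hs
  rw [← hr] at hA1 hA2 hA3
  -- the first bracket
  have hB1 : 1 + 24 * s + (8 + 40 * s) * Real.sqrt (2 * s) ≤ 1 + 12 * r + 24 * r ^ 2 + 60 * r ^ 3 := by
    have h1 : (8 + 40 * s) * Real.sqrt (2 * s) ≤ (8 + 40 * s) * (3 / 2 * r) := mul_le_mul_of_nonneg_left hA1 (by positivity)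
    calc 1 + 24 * s + (8 + 40 * s) * Real.sqrt (2 * s) ≤ 1 + 24 * s + (8 + 40 * s) * (3 / 2 * r) := by linarith
      _ = 1 + 12 * r + 24 * r ^ 2 + 60 * r ^ 3 := by rw [← hrs]; ring
  have hW1 : 9 * (K : ℝ)⁻¹ + Real.sqrt (π / (8 * (s / 2))) ≤ 9 / K + 1 / r := by
    rw [show (9 : ℝ) / K = 9 * (K : ℝ)⁻¹ from div_eq_mul_inv _ _, one_div]; linarith
  have hW2 : 56 / (K : ℝ) ^ 2 + 1 / (4 * s) + 8 / K * Real.sqrt (π / (8 * s)) ≤ 56 / (K : ℝ) ^ 2 + 1 / (4 * r ^ 2) + 8 / (K * r) := by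
    have e1 : 1 / (4 * s) = 1 / (4 * r ^ 2) := by rw [hrs]
    have h3 : 8 / (K : ℝ) * Real.sqrt (π / (8 * s)) ≤ 8 / K * r⁻¹ := mul_le_mul_of_nonneg_left hA3 (by positivity)
    have e2 : 8 / (K : ℝ) * r⁻¹ = 8 / (K * r) := by field_simp
    rw [e1]; rw [e2] at h3; linarith
  have hPeq : 14 * s + 84 * s ^ 2 = 14 * r ^ 2 + 84 * r ^ 4 := by rw [← hrs]; ring
  have hX0 : 0 ≤ (1 + 24 * s + (8 + 40 * s) * Real.sqrt (2 * s)) * (9 * (K : ℝ)⁻¹ + Real.sqrt (π / (8 * (s / 2))))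
      + (14 * s + 84 * s ^ 2) * (2 * π) * (56 / (K : ℝ) ^ 2 + 1 / (4 * s) + 8 / K * Real.sqrt (π / (8 * s))) := by positivity
  calc (π / 2) ^ 4 * ((1 + 24 * s + (8 + 40 * s) * Real.sqrt (2 * s)) * (9 * (K : ℝ)⁻¹ + Real.sqrt (π / (8 * (s / 2))))
        + (14 * s + 84 * s ^ 2) * (2 * π) * (56 / (K : ℝ) ^ 2 + 1 / (4 * s) + 8 / K * Real.sqrt (π / (8 * s))))
      ≤ 7 * ((1 + 24 * s + (8 + 40 * s) * Real.sqrt (2 * s)) * (9 * (K : ℝ)⁻¹ + Real.sqrt (π / (8 * (s / 2))))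
        + (14 * s + 84 * s ^ 2) * (2 * π) * (56 / (K : ℝ) ^ 2 + 1 / (4 * s) + 8 / K * Real.sqrt (π / (8 * s)))) := mul_le_mul_of_nonneg_right h7 hX0
    _ ≤ 7 * ((1 + 12 * r + 24 * r ^ 2 + 60 * r ^ 3) * (9 / K + 1 / r)
        + (14 * r ^ 2 + 84 * r ^ 4) * 7 * (56 / (K : ℝ) ^ 2 + 1 / (4 * r ^ 2) + 8 / (K * r))) := by
        apply mul_le_mul_of_nonneg_left _ (by norm_num)
        rw [hPeq]
        gcongr

/-! ## §2 The two numeric hearts of Region I -/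

/-- ★ **NUMERIC HEART, DIFFERENCED FACTOR DECAYING** (`μ = ν`): for `0 < r ≤ n`, `1 ≤ n`, `2n ≤ N`,
`[(1+12r+24r²+60r³)(9∕N+1∕r) + (14r²+84r⁴)·7·(56∕N²+1∕(4r²)+8∕(Nr))]·min(1,(1∕N+1∕r)³) ≤ 44100∕r` — `r ≤ 1`: the bracket is `≤ 533.5∕r + 12520∕r`; `r ≥ 1`: the bracket is `≤ 13053r²` and
`(1∕N+1∕r)³ ≤ (3∕(2r))³`, `13053·27∕8 < 44054`. [folklore] -/
theorem grad_near_numeric_bound_self {r n N : ℝ} (hr : 0 < r) (hrn : r ≤ n) (hn : 1 ≤ n) (hN : 2 * n ≤ N) :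
    ((1 + 12 * r + 24 * r ^ 2 + 60 * r ^ 3) * (9 / N + 1 / r) + (14 * r ^ 2 + 84 * r ^ 4) * 7 * (56 / N ^ 2 + 1 / (4 * r ^ 2) + 8 / (N * r)))
      * min 1 ((1 / N + 1 / r) ^ 3) ≤ 44100 / r := by
  have hNpos : 0 < N := by linarith
  have hN2 : 2 ≤ N := by linarith
  have hrN : 2 * r ≤ N := by linarith
  have hF1 : 9 / N + 1 / r ≤ 11 / (2 * r) := by
    have h9 : 9 / N ≤ 9 / (2 * r) := div_le_div_of_nonneg_left (by norm_num) (by positivity) hrN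
    have e : 11 / (2 * r) = 9 / (2 * r) + 1 / r := by field_simp; norm_num
    rw [e]; linarith
  have hF10 : 0 ≤ 9 / N + 1 / r := by positivity
  have hF20 : 0 ≤ 56 / N ^ 2 + 1 / (4 * r ^ 2) + 8 / (N * r) := by positivity
  have hP10 : 0 ≤ 1 + 12 * r + 24 * r ^ 2 + 60 * r ^ 3 := by positivity
  have hP20 : 0 ≤ 14 * r ^ 2 + 84 * r ^ 4 := by positivity
  have hmin0 : 0 ≤ min 1 ((1 / N + 1 / r) ^ 3) := le_min zero_le_one (by positivity)
  rcases le_or_gt r 1 with hr1 | hr1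
  · -- `r ≤ 1`
    have hr2 : r ^ 2 ≤ 1 := pow_le_one₀ hr.le hr1
    have hr3 : r ^ 3 ≤ 1 := pow_le_one₀ hr.le hr1
    have hP1 : 1 + 12 * r + 24 * r ^ 2 + 60 * r ^ 3 ≤ 97 := by linarith
    have hP2 : 14 * r ^ 2 + 84 * r ^ 4 ≤ 98 * r ^ 2 := by nlinarith [mul_le_mul_of_nonneg_left hr2 (sq_nonneg r)]
    have hF2 : 56 / N ^ 2 + 1 / (4 * r ^ 2) + 8 / (N * r) ≤ 14 + 1 / (4 * r ^ 2) + 4 / r := by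
      have h1 : 56 / N ^ 2 ≤ 14 := by rw [div_le_iff₀ (by positivity)]; nlinarith
      have h2 : 8 / (N * r) ≤ 4 / r := by rw [div_le_div_iff₀ (by positivity) hr]; nlinarith
      linarith
    have hA : (1 + 12 * r + 24 * r ^ 2 + 60 * r ^ 3) * (9 / N + 1 / r) ≤ 97 * (11 / (2 * r)) := mul_le_mul hP1 hF1 hF10 (by norm_num)
    have hB : (14 * r ^ 2 + 84 * r ^ 4) * 7 * (56 / N ^ 2 + 1 / (4 * r ^ 2) + 8 / (N * r)) ≤ 98 * r ^ 2 * 7 * (14 + 1 / (4 * r ^ 2) + 4 / r) := by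
      gcongr
    have hB' : 98 * r ^ 2 * 7 * (14 + 1 / (4 * r ^ 2) + 4 / r) ≤ 12520 / r := by
      rw [show 98 * r ^ 2 * 7 * (14 + 1 / (4 * r ^ 2) + 4 / r) = 686 * (14 * r ^ 2 + 1 / 4 + 4 * r) by field_simp; ring, le_div_iff₀ hr]
      nlinarith
    have hA' : 97 * (11 / (2 * r)) ≤ 534 / r := by
      rw [show 97 * (11 / (2 * r)) = (1067 / 2) / r by field_simp; ring]
      exact div_le_div_of_nonneg_right (by norm_num) hr.le
    calc _ ≤ ((1 + 12 * r + 24 * r ^ 2 + 60 * r ^ 3) * (9 / N + 1 / r) + (14 * r ^ 2 + 84 * r ^ 4) * 7 * (56 / N ^ 2 + 1 / (4 * r ^ 2) + 8 / (N * r))) * 1 :=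
          mul_le_mul_of_nonneg_left (min_le_left _ _) (by positivity)
      _ ≤ (534 / r + 12520 / r) * 1 := by nlinarith [hA, hB, hB', hA']
      _ = 13054 / r := by ring
      _ ≤ 44100 / r := div_le_div_of_nonneg_right (by norm_num) hr.le
  · -- `r ≥ 1`
    have hr1' : 1 ≤ r := hr1.le
    have h12 : r ≤ r ^ 2 := by nlinarith
    have h23 : r ^ 2 ≤ r ^ 3 := pow_le_pow_right₀ hr1' (by norm_num)
    have h24 : r ^ 2 ≤ r ^ 4 := pow_le_pow_right₀ hr1' (by norm_num)
    have h03 : 1 ≤ r ^ 3 := one_le_pow₀ hr1'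
    have hP1 : 1 + 12 * r + 24 * r ^ 2 + 60 * r ^ 3 ≤ 97 * r ^ 3 := by linarith
    have hP2 : 14 * r ^ 2 + 84 * r ^ 4 ≤ 98 * r ^ 4 := by linarith
    have hF2 : 56 / N ^ 2 + 1 / (4 * r ^ 2) + 8 / (N * r) ≤ 73 / (4 * r ^ 2) := by
      have h1 : 56 / N ^ 2 ≤ 56 / (2 * r) ^ 2 := div_le_div_of_nonneg_left (by norm_num) (by positivity) (pow_le_pow_left₀ (by positivity) hrN 2)
      have h2 : 8 / (N * r) ≤ 8 / (2 * r * r) := div_le_div_of_nonneg_left (by norm_num) (by positivity) (mul_le_mul_of_nonneg_right hrN hr.le)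
      have e : 73 / (4 * r ^ 2) = 56 / (2 * r) ^ 2 + 1 / (4 * r ^ 2) + 8 / (2 * r * r) := by field_simp; ring
      rw [e]; linarith
    have hinv : 1 / N ≤ 1 / (2 * r) := div_le_div_of_nonneg_left (by norm_num) (by positivity) hrN
    have hmin : min 1 ((1 / N + 1 / r) ^ 3) ≤ (3 / (2 * r)) ^ 3 := by
      refine (min_le_right _ _).trans (pow_le_pow_left₀ (by positivity) ?_ 3)
      rw [show 3 / (2 * r) = 1 / (2 * r) + 1 / r by field_simp; norm_num]
      linarith
    have hA : (1 + 12 * r + 24 * r ^ 2 + 60 * r ^ 3) * (9 / N + 1 / r) ≤ 97 * r ^ 3 * (11 / (2 * r)) := mul_le_mul hP1 hF1 hF10 (by positivity)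
    have hB : (14 * r ^ 2 + 84 * r ^ 4) * 7 * (56 / N ^ 2 + 1 / (4 * r ^ 2) + 8 / (N * r)) ≤ 98 * r ^ 4 * 7 * (73 / (4 * r ^ 2)) := by
      gcongr
    calc _ ≤ (97 * r ^ 3 * (11 / (2 * r)) + 98 * r ^ 4 * 7 * (73 / (4 * r ^ 2))) * (3 / (2 * r)) ^ 3 :=
          mul_le_mul (add_le_add hA hB) hmin hmin0 (by positivity)
      _ = (352431 / 8) / r := by field_simp; ring
      _ ≤ 44100 / r := div_le_div_of_nonneg_right (by norm_num) hr.le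

/-- ★ **NUMERIC HEART, A TRANSVERSE FACTOR DECAYING** (`μ ≠ ν`): for `0 < r ≤ n`, `1 ≤ n`, `2n ≤ N`,
`min(2, 2∕r²)·(98r²+588r⁴)(9∕N+1∕r)·min(1,(1∕N+1∕r)²) ≤ 17000∕r` (`r ≤ 1`: `≤ 7546r ≤ 7546∕r`; `r ≥ 1`: `= 16978.5∕r` at the crude ends; only `2r ≤ N` is used). [folklore] -/
theorem grad_near_numeric_bound_trans {r n N : ℝ} (hr : 0 < r) (hrn : r ≤ n) (hN : 2 * n ≤ N) :
    min 2 (2 / r ^ 2) * ((98 * r ^ 2 + 588 * r ^ 4) * (9 / N + 1 / r)) * min 1 ((1 / N + 1 / r) ^ 2) ≤ 17000 / r := by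
  have hNpos : 0 < N := by linarith
  have hrN : 2 * r ≤ N := by linarith
  have hF1 : 9 / N + 1 / r ≤ 11 / (2 * r) := by
    have h9 : 9 / N ≤ 9 / (2 * r) := div_le_div_of_nonneg_left (by norm_num) (by positivity) hrN
    have e : 11 / (2 * r) = 9 / (2 * r) + 1 / r := by field_simp; norm_num
    rw [e]; linarith
  have hF10 : 0 ≤ 9 / N + 1 / r := by positivity
  have hP0 : 0 ≤ 98 * r ^ 2 + 588 * r ^ 4 := by positivity
  have hmin20 : 0 ≤ min 2 (2 / r ^ 2) := le_min zero_le_two (by positivity)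
  have hmin10 : 0 ≤ min 1 ((1 / N + 1 / r) ^ 2) := le_min zero_le_one (by positivity)
  rcases le_or_gt r 1 with hr1 | hr1
  · -- `r ≤ 1`
    have hr2 : r ^ 2 ≤ 1 := pow_le_one₀ hr.le hr1
    have hP : 98 * r ^ 2 + 588 * r ^ 4 ≤ 686 * r ^ 2 := by nlinarith [mul_le_mul_of_nonneg_left hr2 (sq_nonneg r)]
    have hPF : (98 * r ^ 2 + 588 * r ^ 4) * (9 / N + 1 / r) ≤ 686 * r ^ 2 * (11 / (2 * r)) := mul_le_mul hP hF1 hF10 (by positivity)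
    have e : 686 * r ^ 2 * (11 / (2 * r)) = 3773 * r := by field_simp; ring
    rw [e] at hPF
    have hrr : r ≤ 1 / r := by rw [le_div_iff₀ hr]; nlinarith
    calc min 2 (2 / r ^ 2) * ((98 * r ^ 2 + 588 * r ^ 4) * (9 / N + 1 / r)) * min 1 ((1 / N + 1 / r) ^ 2)
        ≤ 2 * (3773 * r) * 1 := mul_le_mul (mul_le_mul (min_le_left _ _) hPF (mul_nonneg hP0 hF10) zero_le_two) (min_le_left _ _) hmin10 (by positivity)
      _ = 7546 * r := by ring
      _ ≤ 7546 * (1 / r) := by gcongr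
      _ = 7546 / r := by ring
      _ ≤ 17000 / r := div_le_div_of_nonneg_right (by norm_num) hr.le
  · -- `r ≥ 1`
    have hr1' : 1 ≤ r := hr1.le
    have h24 : r ^ 2 ≤ r ^ 4 := pow_le_pow_right₀ hr1' (by norm_num)
    have hP : 98 * r ^ 2 + 588 * r ^ 4 ≤ 686 * r ^ 4 := by linarith
    have hPF : (98 * r ^ 2 + 588 * r ^ 4) * (9 / N + 1 / r) ≤ 686 * r ^ 4 * (11 / (2 * r)) := mul_le_mul hP hF1 hF10 (by positivity)
    have hinv : 1 / N ≤ 1 / (2 * r) := div_le_div_of_nonneg_left (by norm_num) (by positivity) hrN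
    have hmin1 : min 1 ((1 / N + 1 / r) ^ 2) ≤ (3 / (2 * r)) ^ 2 := by
      refine (min_le_right _ _).trans (pow_le_pow_left₀ (by positivity) ?_ 2)
      rw [show 3 / (2 * r) = 1 / (2 * r) + 1 / r by field_simp; norm_num]
      linarith
    calc min 2 (2 / r ^ 2) * ((98 * r ^ 2 + 588 * r ^ 4) * (9 / N + 1 / r)) * min 1 ((1 / N + 1 / r) ^ 2)
        ≤ (2 / r ^ 2) * (686 * r ^ 4 * (11 / (2 * r))) * (3 / (2 * r)) ^ 2 :=
          mul_le_mul (mul_le_mul (min_le_right _ _) hPF (mul_nonneg hP0 hF10) (by positivity)) hmin1 hmin10 (by positivity)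
      _ = (33957 / 2) / r := by field_simp; ring
      _ ≤ 17000 / r := div_le_div_of_nonneg_right (by norm_num) hr.le

/-! ## §3 Products over `Fin 4` with one index erased -/

/-- `Π_{μ ≠ ν} a_μ ≤ D³` when `0 ≤ a_μ ≤ D` off `ν`. [folklore] -/
theorem prod_erase_le_pow_three {a : Fin 4 → ℝ} {D : ℝ} (ν : Fin 4) (h0 : ∀ μ, 0 ≤ a μ) (hD : ∀ μ, μ ≠ ν → a μ ≤ D) :
    ∏ μ ∈ Finset.univ.erase ν, a μ ≤ D ^ 3 := by
  classical
  have hcard : (Finset.univ.erase ν).card = 3 := by rw [Finset.card_erase_of_mem (Finset.mem_univ ν), Finset.card_univ, Fintype.card_fin]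
  calc ∏ μ ∈ Finset.univ.erase ν, a μ ≤ ∏ _μ ∈ Finset.univ.erase ν, D :=
        Finset.prod_le_prod (fun μ _ => h0 μ) (fun μ hμ => hD μ (Finset.ne_of_mem_erase hμ))
    _ = D ^ 3 := by rw [Finset.prod_const, hcard]

/-- `Π_{i ≠ ν} a_i ≤ a_μ·D²` when `μ ≠ ν`, `0 ≤ a`, and `a_i ≤ D` off `{ν, μ}`. [folklore] -/
theorem prod_erase_le_mul_pow_two {a : Fin 4 → ℝ} {D : ℝ} {ν μ : Fin 4} (hμν : μ ≠ ν) (h0 : ∀ i, 0 ≤ a i) (hD : ∀ i, i ≠ ν → i ≠ μ → a i ≤ D) :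
    ∏ i ∈ Finset.univ.erase ν, a i ≤ a μ * D ^ 2 := by
  classical
  have hmem : μ ∈ Finset.univ.erase ν := Finset.mem_erase.mpr ⟨hμν, Finset.mem_univ μ⟩
  rw [← Finset.mul_prod_erase (Finset.univ.erase ν) a hmem]
  refine mul_le_mul_of_nonneg_left ?_ (h0 μ)
  have hcard : ((Finset.univ.erase ν).erase μ).card = 2 := by
    rw [Finset.card_erase_of_mem hmem, Finset.card_erase_of_mem (Finset.mem_univ ν), Finset.card_univ, Fintype.card_fin]
  calc ∏ i ∈ (Finset.univ.erase ν).erase μ, a i ≤ ∏ _i ∈ (Finset.univ.erase ν).erase μ, D :=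
        Finset.prod_le_prod (fun i _ => h0 i) (fun i hi => hD i (Finset.ne_of_mem_erase (Finset.mem_of_mem_erase hi)) (Finset.ne_of_mem_erase hi))
    _ = D ^ 2 := by rw [Finset.prod_const, hcard]

/-! ## §4 The majorants of the differenced product on the cubic four-torus -/

variable {K₀ : ℕ} [NeZero K₀]

/-- (G1·B1³) `‖∇Q_s(z_ν)‖·Π_{μ≠ν}‖Q_s(z_μ)‖ ≤ 2` (`s ≥ 0`). [folklore] -/
theorem gradProd_le_two {s : ℝ} (hs : 0 ≤ s) (z : Tor (cM K₀)) (ν : Fin 4) :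
    ‖cycleHeatGrad K₀ s (z ν)‖ * ∏ μ ∈ Finset.univ.erase ν, ‖cycleHeat K₀ s (z μ)‖ ≤ 2 := by
  have h1 := norm_cycleHeatGrad_le_two (K := K₀) hs (z ν)
  have h2 := prod_erase_le_pow_three (a := fun μ => ‖cycleHeat K₀ s (z μ)‖) (D := 1) ν (fun μ => norm_nonneg _) (fun μ _ => norm_cycleHeat_le_one hs (z μ))
  calc _ ≤ 2 * (1 : ℝ) ^ 3 := mul_le_mul h1 h2 (Finset.prod_nonneg fun μ _ => norm_nonneg _) zero_le_two
    _ = 2 := by norm_num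

/-- ★★ **REGION II (every `s > 0`)**: `‖∇Q_s(z_ν)‖·Π_{μ≠ν}‖Q_s(z_μ)‖ ≤ 8·e^{−8s∕K₀²}∕(s·K₀³) + 8∕(s²√s)` — the differenced factor by (G2) `(2∕s)e^{−8s∕K₀²}`, the three others by (B2)
`1∕K₀ + 1∕√s`, and `(a+b)³ ≤ 4(a³+b³)`: NO zero-mode constant (the `1∕K₀³` share keeps the factor `e^{−8s∕K₀²}`, integrable in `s` WITHOUT the mass), NO cross terms.
[cite: King1986, (4.4) p.670, (4.35) p.674, (3.63) p.663] -/
theorem gradProd_le_far {s : ℝ} (hs : 0 < s) (z : Tor (cM K₀)) (ν : Fin 4) :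
    ‖cycleHeatGrad K₀ s (z ν)‖ * ∏ μ ∈ Finset.univ.erase ν, ‖cycleHeat K₀ s (z μ)‖
      ≤ 8 * Real.exp (-(8 * s / (K₀ : ℝ) ^ 2)) / (s * (K₀ : ℝ) ^ 3) + 8 / (s ^ 2 * Real.sqrt s) := by
  have hK : (0 : ℝ) < K₀ := by exact_mod_cast Nat.pos_of_ne_zero (NeZero.ne K₀)
  set r := Real.sqrt s with hr
  have hr0 : 0 < r := Real.sqrt_pos.mpr hs
  have hrs : r ^ 2 = s := Real.sq_sqrt hs.le
  have h1 := norm_cycleHeatGrad_le_two_div_mul_exp (K := K₀) hs (z ν)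
  have hD0 : 0 ≤ (K₀ : ℝ)⁻¹ + r⁻¹ := by positivity
  have h2 := prod_erase_le_pow_three (a := fun μ => ‖cycleHeat K₀ s (z μ)‖) (D := (K₀ : ℝ)⁻¹ + r⁻¹) ν (fun μ => norm_nonneg _)
    (fun μ _ => norm_cycleHeat_le_inv_add_inv_sqrt hs (z μ))
  -- `(a+b)³ ≤ 4(a³+b³)` (the tree's `FluidPDE.Torus.add_pow_three_le`, cited, not imported)
  have h3 : ((K₀ : ℝ)⁻¹ + r⁻¹) ^ 3 ≤ 4 * (((K₀ : ℝ)⁻¹) ^ 3 + (r⁻¹) ^ 3) := by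
    have ha : (0 : ℝ) ≤ (K₀ : ℝ)⁻¹ := by positivity
    have hb : (0 : ℝ) ≤ r⁻¹ := by positivity
    nlinarith [sq_nonneg ((K₀ : ℝ)⁻¹ - r⁻¹), mul_nonneg ha hb, sq_nonneg ((K₀ : ℝ)⁻¹ + r⁻¹)]
  have hE0 : 0 ≤ 2 / s * Real.exp (-(8 * s / (K₀ : ℝ) ^ 2)) := by positivity
  have he1 : Real.exp (-(8 * s / (K₀ : ℝ) ^ 2)) ≤ 1 := by rw [Real.exp_le_one_iff]; exact neg_nonpos.mpr (by positivity)
  calc ‖cycleHeatGrad K₀ s (z ν)‖ * ∏ μ ∈ Finset.univ.erase ν, ‖cycleHeat K₀ s (z μ)‖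
      ≤ (2 / s * Real.exp (-(8 * s / (K₀ : ℝ) ^ 2))) * ((K₀ : ℝ)⁻¹ + r⁻¹) ^ 3 := mul_le_mul h1 h2 (Finset.prod_nonneg fun μ _ => norm_nonneg _) hE0
    _ ≤ (2 / s * Real.exp (-(8 * s / (K₀ : ℝ) ^ 2))) * (4 * (((K₀ : ℝ)⁻¹) ^ 3 + (r⁻¹) ^ 3)) := mul_le_mul_of_nonneg_left h3 hE0
    _ = 8 * Real.exp (-(8 * s / (K₀ : ℝ) ^ 2)) / (s * (K₀ : ℝ) ^ 3) + Real.exp (-(8 * s / (K₀ : ℝ) ^ 2)) * (8 / (s ^ 2 * r)) := by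
        rw [← hrs]; field_simp; ring
    _ ≤ 8 * Real.exp (-(8 * s / (K₀ : ℝ) ^ 2)) / (s * (K₀ : ℝ) ^ 3) + 1 * (8 / (s ^ 2 * r)) := by gcongr
    _ = 8 * Real.exp (-(8 * s / (K₀ : ℝ) ^ 2)) / (s * (K₀ : ℝ) ^ 3) + 8 / (s ^ 2 * r) := by ring

/-- ★★ **REGION I (`0 < s ≤ |v(z_μ)|²`, ANY coordinate `μ` with `z_μ ≠ 0`)**: `‖∇Q_s(z_ν)‖·Π_{μ′≠ν}‖Q_s(z_{μ′})‖ ≤ 308700∕(|v(z_μ)|⁴·√s)` — if `μ = ν` the differenced factor carries the decay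
((G3) and §2's first heart, the three others `≤ min(1, 1∕K₀+1∕√s)`), if `μ ≠ ν` the transverse factor `z_μ` carries it ((B3), the differenced factor by (G1)∧(G2) `min(2, 2∕s)`, the two others
`≤ min(1, 1∕K₀+1∕√s)`, §2's second heart); `r = √s ≤ |v| ≤ K₀∕2`.  The majorant is `O(|v|⁻⁴s^{−1∕2})`: integrable at `0`, and `∫₀^{|v|²} = 2·308700∕|v|³`. [cite: King1986, (4.4) p.670, (4.35) p.674, (3.63) p.663] -/
theorem gradProd_le_near {s : ℝ} (hs : 0 < s) (z : Tor (cM K₀)) (ν μ : Fin 4) (hμ : z μ ≠ 0)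
    (hsn : s ≤ (((z μ).valMinAbs.natAbs : ℕ) : ℝ) ^ 2) :
    ‖cycleHeatGrad K₀ s (z ν)‖ * ∏ μ' ∈ Finset.univ.erase ν, ‖cycleHeat K₀ s (z μ')‖ ≤ 308700 / ((((z μ).valMinAbs.natAbs : ℕ) : ℝ) ^ 4 * Real.sqrt s) := by
  have hK : (0 : ℝ) < K₀ := by exact_mod_cast Nat.pos_of_ne_zero (NeZero.ne K₀)
  set n : ℝ := (((z μ).valMinAbs.natAbs : ℕ) : ℝ) with hn
  have hnat : 1 ≤ (z μ).valMinAbs.natAbs := by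
    rw [Nat.one_le_iff_ne_zero, Ne, Int.natAbs_eq_zero, ZMod.valMinAbs_eq_zero]; exact hμ
  have hn1 : (1 : ℝ) ≤ n := by rw [hn]; exact_mod_cast hnat
  have hN : 2 * n ≤ K₀ := by
    have h : (z μ).valMinAbs.natAbs ≤ K₀ / 2 := ZMod.natAbs_valMinAbs_le (z μ)
    have : 2 * (z μ).valMinAbs.natAbs ≤ K₀ := by omega
    rw [hn]; exact_mod_cast this
  set r : ℝ := Real.sqrt s with hr
  have hr0 : 0 < r := Real.sqrt_pos.mpr hs
  have hrs : r ^ 2 = s := Real.sq_sqrt hs.le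
  have hrn : r ≤ n := by
    rw [hr, ← Real.sqrt_sq (by linarith : (0 : ℝ) ≤ n)]
    exact Real.sqrt_le_sqrt hsn
  have hn4 : (0 : ℝ) < n ^ 4 := by positivity
  set D : ℝ := min 1 ((K₀ : ℝ)⁻¹ + r⁻¹) with hD
  have hD0 : 0 ≤ D := le_min zero_le_one (by positivity)
  have hDμ : ∀ μ', ‖cycleHeat K₀ s (z μ')‖ ≤ D := fun μ' =>
    le_min (norm_cycleHeat_le_one hs.le (z μ')) (norm_cycleHeat_le_inv_add_inv_sqrt hs (z μ'))
  have hDpow : ∀ m : ℕ, D ^ m = min 1 ((1 / (K₀ : ℝ) + 1 / r) ^ m) := by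
    intro m
    rw [hD, one_div, one_div]
    rcases le_total (1 : ℝ) ((K₀ : ℝ)⁻¹ + r⁻¹) with h | h
    · rw [min_eq_left h, min_eq_left (one_le_pow₀ h), one_pow]
    · rw [min_eq_right h, min_eq_right (pow_le_one₀ (by positivity) h)]
  by_cases hμν : μ = ν
  · -- the differenced factor carries the decay
    subst hμν
    have hG := norm_cycleHeatGrad_le_decayPoly (K := K₀) hs hμ
    have hP := prod_erase_le_pow_three (a := fun μ' => ‖cycleHeat K₀ s (z μ')‖) (D := D) μ (fun μ' => norm_nonneg _) (fun μ' _ => hDμ μ')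
    have hnum := grad_near_numeric_bound_self hr0 hrn hn1 hN
    rw [← hDpow 3] at hnum
    have hB0 : 0 ≤ 7 * ((1 + 12 * r + 24 * r ^ 2 + 60 * r ^ 3) * (9 / K₀ + 1 / r) + (14 * r ^ 2 + 84 * r ^ 4) * 7 * (56 / (K₀ : ℝ) ^ 2 + 1 / (4 * r ^ 2) + 8 / (K₀ * r))) / n ^ 4 := by
      positivity
    calc ‖cycleHeatGrad K₀ s (z μ)‖ * ∏ μ' ∈ Finset.univ.erase μ, ‖cycleHeat K₀ s (z μ')‖
        ≤ (7 * ((1 + 12 * r + 24 * r ^ 2 + 60 * r ^ 3) * (9 / K₀ + 1 / r) + (14 * r ^ 2 + 84 * r ^ 4) * 7 * (56 / (K₀ : ℝ) ^ 2 + 1 / (4 * r ^ 2) + 8 / (K₀ * r))) / n ^ 4) * D ^ 3 :=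
          mul_le_mul hG hP (Finset.prod_nonneg fun μ' _ => norm_nonneg _) hB0
      _ = 7 * (((1 + 12 * r + 24 * r ^ 2 + 60 * r ^ 3) * (9 / K₀ + 1 / r) + (14 * r ^ 2 + 84 * r ^ 4) * 7 * (56 / (K₀ : ℝ) ^ 2 + 1 / (4 * r ^ 2) + 8 / (K₀ * r))) * D ^ 3) / n ^ 4 := by ring
      _ ≤ 7 * (44100 / r) / n ^ 4 := by gcongr
      _ = 308700 / (n ^ 4 * r) := by field_simp; ring
  · -- a transverse factor carries the decay
    have hG : ‖cycleHeatGrad K₀ s (z ν)‖ ≤ min 2 (2 / r ^ 2) := by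
      rw [hrs]; exact le_min (norm_cycleHeatGrad_le_two hs.le (z ν)) (norm_cycleHeatGrad_le_two_div hs (z ν))
    have hQ := norm_cycleHeat_le_poly_div (K := K₀) hs hμ
    have hpoly : (98 * s + 588 * s ^ 2) * (9 * (K₀ : ℝ)⁻¹ + (Real.sqrt s)⁻¹) = (98 * r ^ 2 + 588 * r ^ 4) * (9 / K₀ + 1 / r) := by
      rw [← hr, ← hrs]; ring
    rw [hpoly] at hQ
    have hP := prod_erase_le_mul_pow_two (a := fun μ' => ‖cycleHeat K₀ s (z μ')‖) (D := D) hμν (fun μ' => norm_nonneg _) (fun μ' _ _ => hDμ μ')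
    have hnum := grad_near_numeric_bound_trans hr0 hrn hN
    rw [← hDpow 2] at hnum
    have hB0 : 0 ≤ (98 * r ^ 2 + 588 * r ^ 4) * (9 / K₀ + 1 / r) / n ^ 4 * D ^ 2 := by positivity
    calc ‖cycleHeatGrad K₀ s (z ν)‖ * ∏ μ' ∈ Finset.univ.erase ν, ‖cycleHeat K₀ s (z μ')‖
        ≤ min 2 (2 / r ^ 2) * ((98 * r ^ 2 + 588 * r ^ 4) * (9 / K₀ + 1 / r) / n ^ 4 * D ^ 2) := by
          refine mul_le_mul hG (hP.trans (mul_le_mul_of_nonneg_right hQ (pow_nonneg hD0 2))) (Finset.prod_nonneg fun μ' _ => norm_nonneg _) (le_min zero_le_two (by positivity))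
      _ = (min 2 (2 / r ^ 2) * ((98 * r ^ 2 + 588 * r ^ 4) * (9 / K₀ + 1 / r)) * D ^ 2) / n ^ 4 := by ring
      _ ≤ (17000 / r) / n ^ 4 := div_le_div_of_nonneg_right hnum hn4.le
      _ ≤ (308700 / r) / n ^ 4 := by gcongr; norm_num
      _ = 308700 / (n ^ 4 * r) := by field_simp

end Summit.QuantumFields.YangMills.BalabanUVNodes.N15KingModelRung.HeatKernel

end
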